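import Summits.Ventures.PercRepro.RLSRuleLineFree

/-!
# PercRepro — the lifted rule `R₃⁺` at `t = 0` on LINE-FREE planes, part 2: the witnesses and the per-flat
inequality for `U_{3,g}`, every `g ≥ 3`, every `p` (night-3, gen 3)

Sequel of `RLSRuleLineFree.lean` (the trace analysis and the share bound `wPlus_union_ge_of_lineFree`):

* `union_mem_Yq_of_subset`: `B′ ∪ X` is a witness of the middle level for a rank-`3` set `B′ ⊆ G` and an independent
  `X` off `G` with `1 ≤ |X| ≤ p − 4`;
* `witnessFamily K n` (the subsets of `K` of size `1 … n`), `mem_witnessFamily`, and **`sum_witness_eq_phiK`**: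
  `Σ_{X ⊆ K, 1 ≤ |X| ≤ p − 4} 1 / C(3 + |X|, 3) = Φ(p, 3)` for `|K| = p` (by `phiW_eq_phiK_form`);
* **`perFlat_lineFree_of_typeZero`** — for every line-free plane `G` of type `0` (`ρ(E ∖ G) ≥ p`) and every `p`:
  `Φ(p, 3) · #U_G ≤ Σ_{S ∈ Yq} w⁺(G, S)`: the witnesses `(B′, X) ↦ B′ ∪ X` over `U_G × witnessFamily K (p − 4)`
  (`K` an independent `p`-subset of `E ∖ G`) are distinct and each pays at least the triple share, so every `B′ ∈ U_G`
  pays `Φ(p, 3)`.  With `perFlat_three_point` this is the per-flat inequality of `R₃⁺` on the whole family `U_{3,g}`,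
  `g ≥ 3`, at `t = 0`.
Imports `RLSRuleLineFree`.  Axioms: standard.
-/

open scoped Matroid

namespace PercRepro

namespace NightThree

open Finset ThmH PerFlat

variable {α : Type*} [DecidableEq α] {M : Matroid α} [M.Finite]

/-! ### The witnesses and the per-flat inequality -/

/-- `B′ ∪ X` is a witness of the middle level at `(p, 3)` for a rank-`3` set `B′ ⊆ G` and an independent `X` off
`G` with `1 ≤ |X|` and `|X| + 4 ≤ p`. -/
theorem union_mem_Yq_of_subset {G B X : Finset α} (hG : G ∈ flatsQ M 3) (hB : B ⊆ G)
    (hB3 : M.eRk (B : Set α) = 3) (hX : M.Indep (X : Set α)) (hXG : Disjoint X G) {p : ℕ}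
    (h1 : 1 ≤ X.card) (h2 : X.card + 4 ≤ p) : B ∪ X ∈ Yq M p 3 := by
  unfold Yq
  rw [Finset.mem_filter, Finset.mem_powerset]
  refine ⟨?_, ?_, ?_⟩
  · apply Finset.union_subset (hB.trans (mem_flatsQ.1 hG).1)
    rw [← Finset.coe_subset, coe_gr]
    exact hX.subset_ground
  · obtain ⟨x, hx⟩ := Finset.card_pos.1 h1
    have hxE : x ∈ M.E := hX.subset_ground (Finset.mem_coe.2 hx)
    have hxG : x ∉ (G : Set α) := by
      rw [Finset.mem_coe]
      exact Finset.disjoint_left.1 hXG hx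
    have hGflat : M.IsFlat (G : Set α) := (mem_flatsQ.1 hG).2.1
    have hxB : x ∉ M.closure (B : Set α) := fun h =>
      hxG (by
        have := M.closure_subset_closure (Finset.coe_subset.2 hB) h
        rwa [hGflat.closure] at this)
    have hins : M.eRk (insert x (B : Set α)) = 4 := by
      rw [Matroid.eRk_insert_eq_add_one ⟨hxE, hxB⟩, hB3]
      rfl
    have hsub : insert x (B : Set α) ⊆ ((B ∪ X : Finset α) : Set α) := by
      rw [Finset.coe_union]
      exact Set.insert_subset (Set.mem_union_right _ (Finset.mem_coe.2 hx)) Set.subset_union_left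
    have h4 := M.eRk_mono hsub
    rw [hins] at h4
    exact lt_of_lt_of_le (by norm_num) h4
  · calc M.eRk ((B ∪ X : Finset α) : Set α) ≤ M.eRk (B : Set α) + M.eRk (X : Set α) := by
          rw [Finset.coe_union]
          exact M.eRk_union_le_eRk_add_eRk _ _
      _ = 3 + (X.card : ℕ∞) := by rw [hB3, eRk_eq_card_of_indep hX]
      _ < (p : ℕ∞) := by
          have : ((3 + X.card : ℕ) : ℕ∞) < (p : ℕ∞) := by exact_mod_cast (by omega : 3 + X.card < p)
          simpa using this

/-- The witness family of a `p`-set `K`: its subsets of size `1 … p − 4`. -/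
noncomputable def witnessFamily (K : Finset α) (n : ℕ) : Finset (Finset α) :=
  (Finset.Ico 1 (n + 1)).biUnion (fun x => K.powersetCard x)

omit [M.Finite] in
/-- Membership in the witness family. -/
theorem mem_witnessFamily {K X : Finset α} {n : ℕ} (hX : X ∈ witnessFamily K n) :
    X ⊆ K ∧ 1 ≤ X.card ∧ X.card ≤ n := by
  unfold witnessFamily at hX
  rw [Finset.mem_biUnion] at hX
  obtain ⟨x, hx, hXx⟩ := hX
  rw [Finset.mem_Ico] at hx
  rw [Finset.mem_powersetCard] at hXx
  exact ⟨hXx.1, by omega, by omega⟩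

omit [M.Finite] in
/-- **The witness sum is `Φ(p, 3)`**: `Σ_{X ⊆ K, 1 ≤ |X| ≤ p − 4} 1 / C(3 + |X|, 3) = Φ(p, 3)` for `|K| = p = n + 4`. -/
theorem sum_witness_eq_phiK {K : Finset α} {n : ℕ} (hK : K.card = n + 4) :
    ∑ X ∈ witnessFamily K n, 1 / (((3 + X.card).choose 3 : ℕ) : ℚ) = phiK (n + 4) 3 := by
  classical
  unfold witnessFamily
  rw [Finset.sum_biUnion (K.pairwise_disjoint_powersetCard.set_pairwise _)]
  have hinner : ∀ x ∈ Finset.Ico 1 (n + 1),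
      ∑ X ∈ K.powersetCard x, 1 / (((3 + X.card).choose 3 : ℕ) : ℚ) =
        ((n + 4).choose x : ℚ) / (((3 + x).choose 3 : ℕ) : ℚ) := by
    intro x _
    rw [Finset.sum_congr rfl (fun X hX => by
      rw [(Finset.mem_powersetCard.1 hX).2]), Finset.sum_const, Finset.card_powersetCard, hK,
      nsmul_eq_mul, mul_one_div]
  rw [Finset.sum_congr rfl hinner, Finset.sum_Ico_eq_sum_range]
  unfold phiK
  rw [phiW_eq_phiK_form n]
  unfold phiW
  rw [show n + 1 - 1 = n from rfl]
  apply Finset.sum_congr rfl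
  intro i _
  rw [show 1 + i = i + 1 by omega, show 3 + (i + 1) = i + 4 by omega]

/-- **`R₃⁺` on line-free planes at `t = 0`.**  For a line-free plane `G` (every `3` points independent, e.g.
`U_{3,g}`) whose complement has rank `≥ p`, the per-flat inequality holds at `(p, 3)` for every `p`:
`Φ(p, 3) · #U_G ≤ Σ_{S ∈ Yq} w⁺(G, S)`. -/
theorem perFlat_lineFree_of_typeZero {G : Finset α} (hG : G ∈ flatsQ M 3) (hfree : LineFree M G) (p : ℕ)
    (hK : (p : ℕ∞) ≤ M.eRk ((gr M \ G : Finset α) : Set α)) :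
    phiK p 3 * ((UqG M p 3 G).card : ℚ) ≤ ∑ S ∈ Yq M p 3, wPlus M G S := by
  classical
  have hsupply : 0 ≤ ∑ S ∈ Yq M p 3, wPlus M G S := Finset.sum_nonneg (fun S _ => wPlus_nonneg M G S)
  rcases lt_or_ge p 4 with hp | hp
  · have h0 : phiK p 3 = 0 := by
      unfold phiK
      rw [Finset.Ioo_eq_empty_of_le (by omega), Finset.sum_empty, zero_div]
    rw [h0, zero_mul]
    exact hsupply
  obtain ⟨n, rfl⟩ : ∃ n, p = n + 4 := ⟨p - 4, by omega⟩
  -- an independent `p`-subset `K` of `E ∖ G`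
  have hsubE : ((gr M \ G : Finset α) : Set α) ⊆ M.E := by
    rw [← coe_gr M]
    exact Finset.coe_subset.2 Finset.sdiff_subset
  obtain ⟨I, hI⟩ := M.exists_isBasis _ hsubE
  have hIfin : I.Finite := (gr M \ G).finite_toSet.subset hI.subset
  have hIcard : n + 4 ≤ hIfin.toFinset.card := by
    have h1 := hI.encard_eq_eRk
    rw [← hIfin.coe_toFinset, Set.encard_coe_eq_coe_finsetCard] at h1
    rw [← h1] at hK
    exact_mod_cast hK
  obtain ⟨K, hKI, hKcard⟩ := Finset.exists_subset_card_eq hIcard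
  have hKsub : (K : Set α) ⊆ I := by
    rw [← hIfin.coe_toFinset]
    exact Finset.coe_subset.2 hKI
  have hKind : M.Indep (K : Set α) := hI.indep.subset hKsub
  have hKG : Disjoint K G := by
    rw [Finset.disjoint_left]
    intro x hxK hxG
    have hx := hI.subset (hKsub (Finset.mem_coe.2 hxK))
    rw [Finset.coe_sdiff, Set.mem_sdiff] at hx
    exact hx.2 (Finset.mem_coe.2 hxG)
  -- the witnesses `(B′, X) ↦ B′ ∪ X`
  have hBmem : ∀ B ∈ UqG M (n + 4) 3 G, B ⊆ G ∧ M.eRk (B : Set α) = 3 := by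
    intro B hB
    unfold UqG at hB
    rw [Finset.mem_filter, mem_Uq] at hB
    exact ⟨hB.2, by exact_mod_cast hB.1.2.1⟩
  have himg : (UqG M (n + 4) 3 G ×ˢ witnessFamily K n).image (fun q => q.1 ∪ q.2) ⊆
      Yq M (n + 4) 3 := by
    intro S hS
    rw [Finset.mem_image] at hS
    obtain ⟨⟨B, X⟩, hq, rfl⟩ := hS
    rw [Finset.mem_product] at hq
    obtain ⟨hBG, hB3⟩ := hBmem B hq.1
    obtain ⟨hXK, h1, h2⟩ := mem_witnessFamily hq.2
    exact union_mem_Yq_of_subset hG hBG hB3 (hKind.subset (Finset.coe_subset.2 hXK))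
      (Finset.disjoint_of_subset_left hXK hKG) h1 (by omega)
  have hinj : Set.InjOn (fun q : Finset α × Finset α => q.1 ∪ q.2)
      ((UqG M (n + 4) 3 G ×ˢ witnessFamily K n : Finset (Finset α × Finset α)) :
        Set (Finset α × Finset α)) := by
    intro q hq q' hq' h
    obtain ⟨B, X⟩ := q
    obtain ⟨B', X'⟩ := q'
    rw [Finset.mem_coe, Finset.mem_product] at hq hq'
    have hBG := (hBmem B hq.1).1
    have hBG' := (hBmem B' hq'.1).1
    have hXG : Disjoint X G := Finset.disjoint_of_subset_left (mem_witnessFamily hq.2).1 hKG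
    have hXG' : Disjoint X' G := Finset.disjoint_of_subset_left (mem_witnessFamily hq'.2).1 hKG
    have h' : B ∪ X = B' ∪ X' := h
    have e1 : G ∩ (B ∪ X) = G ∩ (B' ∪ X') := by rw [h']
    rw [inter_union_eq_of_disjoint hBG hXG, inter_union_eq_of_disjoint hBG' hXG'] at e1
    have e2 : (B ∪ X) \ B = (B' ∪ X') \ B' := by rw [h', e1]
    rw [Finset.union_sdiff_cancel_left (Finset.disjoint_of_subset_right hBG hXG).symm,
      Finset.union_sdiff_cancel_left (Finset.disjoint_of_subset_right hBG' hXG').symm] at e2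
    rw [e1, e2]
  have hprod : ∑ q ∈ UqG M (n + 4) 3 G ×ˢ witnessFamily K n, 1 / (((3 + q.2.card).choose 3 : ℕ) : ℚ)
      = phiK (n + 4) 3 * ((UqG M (n + 4) 3 G).card : ℚ) := by
    rw [Finset.sum_product]
    dsimp only
    rw [Finset.sum_congr rfl (fun B _ => sum_witness_eq_phiK hKcard), Finset.sum_const, nsmul_eq_mul,
      mul_comm]
  calc phiK (n + 4) 3 * ((UqG M (n + 4) 3 G).card : ℚ)
      = ∑ q ∈ UqG M (n + 4) 3 G ×ˢ witnessFamily K n, 1 / (((3 + q.2.card).choose 3 : ℕ) : ℚ) :=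
        hprod.symm
    _ ≤ ∑ q ∈ UqG M (n + 4) 3 G ×ˢ witnessFamily K n, wPlus M G (q.1 ∪ q.2) := by
        apply Finset.sum_le_sum
        intro q hq
        obtain ⟨B, X⟩ := q
        rw [Finset.mem_product] at hq
        obtain ⟨hBG, hB3⟩ := hBmem B hq.1
        obtain ⟨hXK, _, _⟩ := mem_witnessFamily hq.2
        exact wPlus_union_ge_of_lineFree hG hfree hBG (three_le_card_of_eRk_eq_three hB3)
          (hKind.subset (Finset.coe_subset.2 hXK)) (Finset.disjoint_of_subset_left hXK hKG)
    _ = ∑ S ∈ (UqG M (n + 4) 3 G ×ˢ witnessFamily K n).image (fun q => q.1 ∪ q.2), wPlus M G S :=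
        (Finset.sum_image hinj).symm
    _ ≤ ∑ S ∈ Yq M (n + 4) 3, wPlus M G S :=
        Finset.sum_le_sum_of_subset_of_nonneg himg (fun S _ _ => wPlus_nonneg M G S)

end NightThree

end PercRepro
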